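import Summits.CriticalPhenomena.Ising3DConformalLimit.Theses.PlantedPinning
import Summits.CriticalPhenomena.Ising3DConformalLimit.Theses.LocalisationClock
import Summits.CriticalPhenomena.Ising3DConformalLimit.Theses.LeeYangGap
import Summits.CriticalPhenomena.Ising3DConformalLimit.Theorems.PlantedPinningPinningEfficiencyDeficitOfSlack
import Summits.CriticalPhenomena.Ising3DConformalLimit.Theorems.LeeYangGapGaussianLimitKillsBlockCoupling

/-!
# Strategy census s8 — typed attempts (crux `PinningEfficiencyDeficit`, item stmt-CriticalPhenomena-8451)

Companion to `Cruxes/PinningEfficiencyDeficit/STRATEGY-CENSUS-s8.md` (independent census seat s8).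
Every statement named in the census is typed here over existing declarations, and every claimed
implication is proved sorry-free:

* `NonSaturation` — the weakest replacement of the crux inside the route's `closes`
  (limsup-in-`p`, limsup-in-`L` form); `nonSaturation_of_deficit`, `closes_of_nonSaturation`.
* `BlockCouplingNonvanishing` — the weaker, already-filed intermediate for clause (iii)
  (`¬ g_L → 0`, implied by `LocalisationClock.Target` = item stmt-CriticalPhenomena-15881) and the
  proof that it ALREADY decides the sub-problem with the route's imported complement and the PROVED
  Gaussian-side glue `gaussianLimitKillsBlockCoupling_proof` (item 4950):
  `closes_of_blockCouplingNonvanishing` — so `PinningEfficiencyDeficit ∧ GaussianPinningSaturation`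
  (two open XL items) is dominated by one existing open item.
* `CsSlackWindow` (= registered S1, verbatim), `PlantedTransfer`, `deficit_of_bridgeSplit` — the best
  typed decomposition found (a bridge split; NOT filed: piece 2 has no plan, piece 1 is 15881).
* `DeficitAllDimensions` — the d-uniform strengthening S⁺ (stated only; false for d ≥ 5 under
  Gaussian triviality, so any proof of the crux must be quantitatively d = 3-specific).

Nothing here is a route item or a registered line; no `sorry`.
-/

namespace Summit.CriticalPhenomena.Ising3DConformalLimit.Cruxes.PinningEfficiencyDeficit.CensusS8

open Summit.CriticalPhenomena.Ising3DConformalLimit.Theses.PlantedPinning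

/-! ## 1. Weakest replacement of the crux inside `closes` -/

/-- W₁ (NonSaturation): for some `ε > 0`, along SOME sequence `p ↓ 0` and, for each such `p`, along
SOME sequence `L → ∞`, `e_L(⌈p·n⌉) ≤ 1 − ε`.  Strictly weaker than the crux (∃∀ → ∀∃ twice) and still
sufficient for `closes` (below).  Same hard core: a `p`-uniform strict deficit at diverging scale. -/
def NonSaturation : Prop :=
  let βc : ℝ := Literature.Probability.LatticeModels.criticalBeta 3; let M : ℕ → Literature.Probability.LatticeModels.SpinConfig (Literature.Probability.LatticeModels.Site 3) → ℝ := fun L σ => ∑ x ∈ Literature.Probability.LatticeModels.box 3 L, Literature.Probability.LatticeModels.spinAt x σ; let cvar : ℕ → Finset (Literature.Probability.LatticeModels.Site 3) → Literature.Probability.LatticeModels.SpinConfig (Literature.Probability.LatticeModels.Site 3) → ℝ := fun L P η => Literature.Probability.LatticeModels.isingExpect (Literature.Probability.LatticeModels.zdGraph 3) (Literature.Probability.LatticeModels.box 3 L \ P) βc 0 (.fixed η) (fun σ => M L σ ^ 2) - Literature.Probability.LatticeModels.isingExpect (Literature.Probability.LatticeModels.zdGraph 3) (Literature.Probability.LatticeModels.box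 3 L \ P) βc 0 (.fixed η) (M L) ^ 2; let pvar : ℕ → ℕ → ℝ := fun L k => (∑ P ∈ (Literature.Probability.LatticeModels.box 3 L).powersetCard k, ∑ τ : ↥(Literature.Probability.LatticeModels.box 3 L) → ℤˣ, Literature.Probability.LatticeModels.isingWeight (Literature.Probability.LatticeModels.zdGraph 3) (Literature.Probability.LatticeModels.box 3 L) βc 0 .plus τ / Literature.Probability.LatticeModels.isingPartitionFunction (Literature.Probability.LatticeModels.zdGraph 3) (Literature.Probability.LatticeModels.box 3 L) βc 0 .plus * cvar L P (Literature.Probability.LatticeModels.glue (Literature.Probability.LatticeModels.box 3 L) τ .plus)) / ((Literature.Probability.LatticeModels.box 3 L).card.choose k : ℝ); let eff : ℕ → ℕ → ℝ := fun L k => (k : ℝ) * pvar L k / ((((Literature.Probability.LatticeModels.box 3 L).card : ℝ) + 1) * (((Literature.Probability.LatticeModels.box 3 L).card : ℝ) - k + 1)); ∃ ε : ℝ, 0 < ε ∧ ∀ p₀ : ℝ, 0 < p₀ → ∃ p : ℝ, 0 < p ∧ p < p₀ ∧ ∀ L₀ : ℕ, ∃ L ≥ L₀, eff L ⌈p * ((Literature.Probability.LatticeModels.box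 3 L).card : ℝ)⌉₊ ≤ 1 - ε

/-- The crux implies its limsup form. -/
theorem nonSaturation_of_deficit : PinningEfficiencyDeficit → NonSaturation := by
  intro hDef
  obtain ⟨ε, hε, p₀, hp₀, hdef⟩ := hDef
  refine ⟨ε, hε, ?_⟩
  intro p₁ hp₁
  refine ⟨min p₀ p₁ / 2, by positivity, ?_, ?_⟩
  · have : min p₀ p₁ ≤ p₁ := min_le_right p₀ p₁
    linarith
  · intro L₀
    have hle₀ : min p₀ p₁ ≤ p₀ := min_le_left p₀ p₁
    have hmin : 0 < min p₀ p₁ := lt_min hp₀ hp₁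
    obtain ⟨L₁, hL₁⟩ := hdef (min p₀ p₁ / 2) (by positivity) (by linarith)
    exact ⟨max L₀ L₁, le_max_left L₀ L₁, hL₁ (max L₀ L₁) (le_max_right L₀ L₁)⟩

/-- `closes` goes through with the crux replaced by `NonSaturation` (same proof by contradiction:
saturation is an `∀ p < p₁, ∀ L ≥ L₁` statement, so one `(p, L)` of the deficit suffices). -/
theorem closes_of_nonSaturation :
    NonSaturation → GaussianPinningSaturation → MoebiusLimitExists → _root_.Ising3DConformalLimit := by
  intro hNS hSat hMoeb
  obtain ⟨ρ, Δ, S, hρ, hΔ, hlim, hnd, hmob⟩ := hMoeb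
  refine ⟨ρ, Δ, S, hρ, hΔ, hlim, hnd, hmob, ?_⟩
  by_contra hU4
  obtain ⟨ε, hε, hns⟩ := hNS
  obtain ⟨p₁, hp₁, hsat⟩ := hSat ρ Δ S hρ hΔ hlim hnd hmob hU4 (ε / 2) (by linarith)
  obtain ⟨p, hp, hpp₁, hfreq⟩ := hns p₁ hp₁
  obtain ⟨L₁, hL₁⟩ := hsat p hp hpp₁
  obtain ⟨L, hL, hle⟩ := hfreq L₁
  have h₁ := hL₁ L hL
  linarith

/-! ## 2. The weaker intermediate already in the tree: block-coupling non-vanishing -/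

/-- W₀ (BlockCouplingNonvanishing): the dimensionless block coupling
`g_L = (3⟨M_L²⟩² − ⟨M_L⁴⟩)/⟨M_L²⟩²` of the critical `+` state on ℤ³ does not tend to `0`
(expression verbatim that of items 4950 / 15881). -/
def BlockCouplingNonvanishing : Prop :=
  ¬ Filter.Tendsto (fun L : ℕ => (3 * (Literature.Probability.LatticeModels.plusExpect 3 (Literature.Probability.LatticeModels.criticalBeta 3) 0 (fun σ => (∑ x ∈ Literature.Probability.LatticeModels.box 3 L, Literature.Probability.LatticeModels.spinAt x σ) ^ 2)) ^ 2 - Literature.Probability.LatticeModels.plusExpect 3 (Literature.Probability.LatticeModels.criticalBeta 3) 0 (fun σ => (∑ x ∈ Literature.Probability.LatticeModels.box 3 L, Literature.Probability.LatticeModels.spinAt x σ) ^ 4)) / (Literature.Probability.LatticeModels.plusExpect 3 (Literature.Probability.LatticeModels.criticalBeta 3) 0 (fun σ => (∑ x ∈ Literature.Probability.LatticeModels.box 3 L, Literature.Probability.LatticeModels.spinAt x σ) ^ 2)) ^ 2) Filter.atTop (nhds 0)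

/-- `LocalisationClock.Target` (item stmt-CriticalPhenomena-15881, the block Binder floor
`∃ c > 0, ∀ L ≥ L₀, c ≤ g_L`) implies W₀. -/
theorem blockCouplingNonvanishing_of_target :
    Summit.CriticalPhenomena.Ising3DConformalLimit.Theses.LocalisationClock.Target →
      BlockCouplingNonvanishing := by
  intro hT ht
  obtain ⟨c, hc, L₀, hL₀⟩ := hT
  have hev := ht.eventually (gt_mem_nhds hc)
  obtain ⟨L, hL1, hL2⟩ := (hev.and (Filter.eventually_ge_atTop L₀)).exists
  exact absurd (hL₀ L hL2) (not_le.mpr hL1)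

/-- W₀ ALREADY decides the sub-problem together with the route's imported complement
`MoebiusLimitExists`, using only the PROVED Gaussian-side glue of item 4950
(`gaussianLimitKillsBlockCoupling_proof`).  Compare the route's `closes`, which needs the two OPEN
items `PinningEfficiencyDeficit` (this crux) and `GaussianPinningSaturation` in the same slot. -/
theorem closes_of_blockCouplingNonvanishing :
    BlockCouplingNonvanishing → MoebiusLimitExists → _root_.Ising3DConformalLimit := by
  intro hW hMoeb
  obtain ⟨ρ, Δ, S, hρ, hΔ, hlim, hnd, hmob⟩ := hMoeb
  refine ⟨ρ, Δ, S, hρ, hΔ, hlim, hnd, hmob, ?_⟩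
  by_contra hU4
  exact hW
    (Summit.CriticalPhenomena.Ising3DConformalLimit.LeeYangGapGaussianLimitKillsBlockCoupling.gaussianLimitKillsBlockCoupling_proof
      ρ Δ S hρ hlim hnd hmob.isScaleCovariant hU4)

/-- Hence the block Binder floor (item 15881) decides the sub-problem with the imported complement. -/
theorem closes_of_target :
    Summit.CriticalPhenomena.Ising3DConformalLimit.Theses.LocalisationClock.Target →
      MoebiusLimitExists → _root_.Ising3DConformalLimit :=
  fun hT => closes_of_blockCouplingNonvanishing (blockCouplingNonvanishing_of_target hT)

/-! ## 3. Best typed decomposition found (bridge split — not filed) -/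

/-- The registered stub S1 of `Lines/birth.lean` (`__Registered.stub_csSlackWindow`), verbatim:
a strict, `p`-uniform Cauchy–Schwarz/Jensen slack of the planted pinning flow on the density window
`[⌈pn⌉/2, ⌈pn⌉)`. -/
abbrev CsSlackWindow : Prop := (fun (βc : ℝ) (M : ℕ → Literature.Probability.LatticeModels.SpinConfig (Literature.Probability.LatticeModels.Site 3) → ℝ) => (fun (pvar csq : ℕ → ℕ → ℝ) => ∃ s : ℝ, 0 < s ∧ ∃ p₀ : ℝ, 0 < p₀ ∧ ∀ p : ℝ, 0 < p → p < p₀ → ∃ L₀ : ℕ, ∀ L ≥ L₀, ∀ j : ℕ, ⌈p * ((Literature.Probability.LatticeModels.box 3 L).card : ℝ)⌉₊ ≤ 2 * j → j < ⌈p * ((Literature.Probability.LatticeModels.box 3 L).card : ℝ)⌉₊ → (1 + s) * pvar L j ^ 2 ≤ csq L j) (fun (L k : ℕ) => (∑ P ∈ (Literature.Probability.LatticeModels.box 3 L).powersetCard k, ∑ τ : ↥(Literature.Probability.LatticeModels.box 3 L) → ℤˣ, Literature.Probability.LatticeModels.isingWeight (Literature.Probability.LatticeModels.zdGraph 3) (Literature.Probability.LatticeModels.box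 3 L) βc 0 .plus τ / Literature.Probability.LatticeModels.isingPartitionFunction (Literature.Probability.LatticeModels.zdGraph 3) (Literature.Probability.LatticeModels.box 3 L) βc 0 .plus * (Literature.Probability.LatticeModels.isingExpect (Literature.Probability.LatticeModels.zdGraph 3) (Literature.Probability.LatticeModels.box 3 L \ P) βc 0 (.fixed (Literature.Probability.LatticeModels.glue (Literature.Probability.LatticeModels.box 3 L) τ .plus)) (fun σ => M L σ ^ 2) - Literature.Probability.LatticeModels.isingExpect (Literature.Probability.LatticeModels.zdGraph 3) (Literature.Probability.LatticeModels.box 3 L \ P) βc 0 (.fixed (Literature.Probability.LatticeModels.glue (Literature.Probability.LatticeModels.box 3 L) τ .plus)) (M L) ^ 2)) / ((Literature.Probability.LatticeModels.box 3 L).card.choose k : ℝ)) (fun (L j : ℕ) => (∑ P ∈ (Literature.Probability.LatticeModels.box 3 L).powersetCard j, ∑ τ : ↥(Literature.Probability.LatticeModels.box 3 L) → ℤˣ, Literature.Probability.LatticeModels.isingWeight (Literature.Probability.LatticeModels.zdGraph 3) (Literature.Probability.LatticeModels.box 3 L) βc 0 .plus τ / Literature.Probability.LatticeModels.isingPartitionFunction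 (Literature.Probability.LatticeModels.zdGraph 3) (Literature.Probability.LatticeModels.box 3 L) βc 0 .plus * ((((Literature.Probability.LatticeModels.box 3 L).card : ℝ) - j) * ∑ z ∈ Literature.Probability.LatticeModels.box 3 L \ P, (Literature.Probability.LatticeModels.isingExpect (Literature.Probability.LatticeModels.zdGraph 3) (Literature.Probability.LatticeModels.box 3 L \ P) βc 0 (.fixed (Literature.Probability.LatticeModels.glue (Literature.Probability.LatticeModels.box 3 L) τ .plus)) (fun σ => M L σ * Literature.Probability.LatticeModels.spinAt z σ) - Literature.Probability.LatticeModels.isingExpect (Literature.Probability.LatticeModels.zdGraph 3) (Literature.Probability.LatticeModels.box 3 L \ P) βc 0 (.fixed (Literature.Probability.LatticeModels.glue (Literature.Probability.LatticeModels.box 3 L) τ .plus)) (M L) * Literature.Probability.LatticeModels.isingExpect (Literature.Probability.LatticeModels.zdGraph 3) (Literature.Probability.LatticeModels.box 3 L \ P) βc 0 (.fixed (Literature.Probability.LatticeModels.glue (Literature.Probability.LatticeModels.box 3 L) τ .plus)) (fun σ => Literature.Probability.LatticeModels.spinAt z σ)) ^ 2)) / ((Literature.Probability.LatticeModels.box 3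 L).card.choose j : ℝ))) (Literature.Probability.LatticeModels.criticalBeta 3) (fun (L : ℕ) (σ : Literature.Probability.LatticeModels.SpinConfig (Literature.Probability.LatticeModels.Site 3)) => ∑ x ∈ Literature.Probability.LatticeModels.box 3 L, Literature.Probability.LatticeModels.spinAt x σ)

/-- Piece 2 of the bridge split: block Binder floor ⇒ planted slack.  Open, XL, no plan: it needs
the converse direction "non-Gaussian block law ⇒ value-dependent conditional covariances at scale
`L*(p)`, uniformly in `p`", i.e. a conditional (pinned) quantitative CLT-failure nobody has. -/
def PlantedTransfer : Prop :=
  Summit.CriticalPhenomena.Ising3DConformalLimit.Theses.LocalisationClock.Target → CsSlackWindow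

/-- The split assembles (sorry-free) through the landed `S1 → crux` composition
`PlantedPinningDeficit.pinningEfficiencyDeficit_of_csSlackWindow` (p144818). -/
theorem deficit_of_bridgeSplit :
    Summit.CriticalPhenomena.Ising3DConformalLimit.Theses.LocalisationClock.Target →
      PlantedTransfer → PinningEfficiencyDeficit :=
  fun hT hPT =>
    Summit.CriticalPhenomena.Ising3DConformalLimit.PlantedPinningDeficit.pinningEfficiencyDeficit_of_csSlackWindow
      (hPT hT)

/-- …but piece 1 alone already gives the sub-problem modulo the SAME imported complement
(`closes_of_target`), so as a decomposition OF THIS CRUX the split is idle: the planted half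
(`PlantedTransfer`) is pure overhead once `Target` is in hand. -/
theorem bridgeSplit_is_idle :
    Summit.CriticalPhenomena.Ising3DConformalLimit.Theses.LocalisationClock.Target →
      MoebiusLimitExists → _root_.Ising3DConformalLimit :=
  closes_of_target

/-! ## 4. The d-uniform strengthening S⁺ (stated only) -/

/-- S⁺ (DeficitAllDimensions): the same deficit at `β_c(d)` for every `d ≥ 2`.  Under Gaussian
triviality of the scaling limit for `d ≥ 5` (Aizenman 1982 / Fröhlich 1982; `d = 4`
Aizenman–Duminil-Copin 2021) and the route's own `GaussianPinningSaturation` mechanism this is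
false, so no `d`-uniform argument can prove the crux. -/
def DeficitAllDimensions : Prop :=
  ∀ d : ℕ, 2 ≤ d →
  let βc : ℝ := Literature.Probability.LatticeModels.criticalBeta d; let M : ℕ → Literature.Probability.LatticeModels.SpinConfig (Literature.Probability.LatticeModels.Site d) → ℝ := fun L σ => ∑ x ∈ Literature.Probability.LatticeModels.box d L, Literature.Probability.LatticeModels.spinAt x σ; let cvar : ℕ → Finset (Literature.Probability.LatticeModels.Site d) → Literature.Probability.LatticeModels.SpinConfig (Literature.Probability.LatticeModels.Site d) → ℝ := fun L P η => Literature.Probability.LatticeModels.isingExpect (Literature.Probability.LatticeModels.zdGraph d) (Literature.Probability.LatticeModels.box d L \ P) βc 0 (.fixed η) (fun σ => M L σ ^ 2) - Literature.Probability.LatticeModels.isingExpect (Literature.Probability.LatticeModels.zdGraph d) (Literature.Probability.LatticeModels.box d L \ P) βc 0 (.fixed η) (M L) ^ 2; let pvar : ℕ → ℕ → ℝ := fun L k => (∑ P ∈ (Literature.Probability.LatticeModels.box d L).powersetCard k, ∑ τ : ↥(Literature.Probability.LatticeModels.box d L) → ℤˣ, Literature.Probability.LatticeModels.isingWeight (Literature.Probability.LatticeModels.zdGraph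 d) (Literature.Probability.LatticeModels.box d L) βc 0 .plus τ / Literature.Probability.LatticeModels.isingPartitionFunction (Literature.Probability.LatticeModels.zdGraph d) (Literature.Probability.LatticeModels.box d L) βc 0 .plus * cvar L P (Literature.Probability.LatticeModels.glue (Literature.Probability.LatticeModels.box d L) τ .plus)) / ((Literature.Probability.LatticeModels.box d L).card.choose k : ℝ); let eff : ℕ → ℕ → ℝ := fun L k => (k : ℝ) * pvar L k / ((((Literature.Probability.LatticeModels.box d L).card : ℝ) + 1) * (((Literature.Probability.LatticeModels.box d L).card : ℝ) - k + 1)); ∃ ε : ℝ, 0 < ε ∧ ∃ p₀ : ℝ, 0 < p₀ ∧ ∀ p : ℝ, 0 < p → p < p₀ → ∃ L₀ : ℕ, ∀ L ≥ L₀, eff L ⌈p * ((Literature.Probability.LatticeModels.box d L).card : ℝ)⌉₊ ≤ 1 - ε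

/-- S⁺ specialises to the crux (d = 3). -/
theorem deficit_of_allDimensions : DeficitAllDimensions → PinningEfficiencyDeficit :=
  fun h => h 3 (by norm_num)

end Summit.CriticalPhenomena.Ising3DConformalLimit.Cruxes.PinningEfficiencyDeficit.CensusS8
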